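import Literature.AlgebraicGeometry.Motives.ZetaFunctionalEquationSignUnique
import HarnessLib

/-!
# The Euler characteristic `χ` of the functional equation `Z(1/(qⁿT)) = ±q^{nχ/2}T^χ Z(T)` is well defined:
# for `Z(0) ≠ 0` every presentation has `χ = deg B − deg A`; hence `HasFunctionalEquation q n Z χ` pins `χ`,
# `χ = Σ(−1)ⁱbᵢ(X)` for `Z = Z(X, T)` in a Galois Weil cohomology, and `χ(ℰ_{2l+3}) = χ(ℋ_{2l+3}) = 2l+4`

Topic `Literature/AlgebraicGeometry/Motives`; THEOREMS ONLY (no definition, no instance, no named fact; D-0026).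
Companion of row g52-#4 (`Motives/ZetaFunctionalEquationSignUnique`: the SIGN `ε` is presentation independent).
In the tree's `Motives/ZetaFunction.HasFunctionalEquation q n Z χ` (Weil 1949; Hartshorne App. C Thm. 4.4 «where
`E` is the self-intersection number of the diagonal»; Kahn 2020 Thm. 3.65 `χ = Σ(−1)ⁱ deg Pᵢ`) the integer `χ` is a
free parameter of the cross-multiplied identity `T^{χ⁻}·Ã·B = ε·q^{nχ/2}·T^{χ⁺}·A·B̃`.  Comparing DEGREES of the
two sides (`deg Ã = deg B̃ = N` as soon as `A(0), B(0) ≠ 0`: the top coefficient of `T^N p(c/T)` is `p(0)`, g52-#4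
`coeff_reflectScale_self`) gives `χ⁻ + N + deg B = χ⁺ + deg A + N`, i.e. **`χ = deg B − deg A`**
(`functionalEquation_eulerChar_eq`, §1), for every presentation of a series with `Z(0) ≠ 0` — in particular for
every zeta function (`Z(X, 0) = 1`).  Consequences:

* §1 (pure) `natDegree_reflectScale_le`, `natDegree_reflectScale_of_coeff_zero_ne_zero` (`deg T^N p(c/T) = N` when
  `p(0) ≠ 0`), **`functionalEquation_eulerChar_eq`**, **`HasFunctionalEquation.eulerChar_unique`**
  (`HasFunctionalEquation q n Z χ → HasFunctionalEquation q n Z χ' → χ = χ'` for `Z(0) ≠ 0`), and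
  `HasFunctionalEquation.eulerChar_eq_natDegree_sub` (`χ = deg B − deg A` for ANY rational presentation `Z·B = A`,
  `B(0) ≠ 0` — by the tree's presentation independence `natDegree_sub_natDegree_eq`).
* §2 (`E` over `𝔽_q` with the Lefschetz trace formula and `χ(φ) = q`; no RH) **`eulerChar_eq_of_hasFunctionalEquation`**:
  `HasFunctionalEquation q d (Z(X,T)) χ ⟹ χ = Σ_{i≤2d}(−1)ⁱ bᵢ(X)` — the exponent of ANY functional equation satisfied
  by `Z(X, T)` is the `E`-Euler characteristic (Kahn Thm. 3.65 read backwards; the tree's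
  `natDegree_sub_natDegree_eq_eulerChar`).
* §3 (E-free) the quadrics of `ℙ^{2l+3}`: **`eulerChar_eq_of_hasFunctionalEquation_ellipticQuadric`** ∕ `…_splitQuadric`
  (`χ = 2l+4` in every functional equation of `Z(ℰ)`, `Z(ℋ)`: their denominators `∏_{i≤2l+2}(1 − qⁱT)·(1 ± q^{l+1}T)`
  have degree exactly `2l+4` and numerator `1`).

HC is not touched.

## References

* [Kahn2020] B. Kahn, Zeta and L-Functions of Varieties and Motives (2020), §3.6 Thm. 3.65, (3.6.6), Remark 3.66.
* [Hartshorne1977] R. Hartshorne, Algebraic Geometry (1977), App. C §1 (1.2), Thm. 4.4.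
* [Weil1949] A. Weil, Bull. AMS 55 (1949), p. 507.
* [Hirschfeld1998] J. W. P. Hirschfeld, Projective Geometries over Finite Fields (1998), §5.2 Thm. 5.2.6.
* Tree: `Motives/ZetaFunction`, `Motives/ZetaFunctionalEquationSignUnique` (g52-#4), `Motives/ZetaFunctionalEquationSignOddDimension`
  (`natDegree_sub_natDegree_eq_eulerChar`), `NumberTheory/LFunctions/WeilConjecturesFunctionalEquationProofs`
  (`natDegree_sub_natDegree_eq`), `Motives/EllipticQuadricPointCount`, `Motives/SplitQuadricPointCount`.

## Provenance

Lane `lit-hodgefound` (summit `HodgeConjecture`, Track 2 foundations library, Layer B: motives ∕ zeta functions),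
seat `lit-hodgefound-p29` (literature-prover, generation 52, row g52-#5).
-/

universe u v

open Polynomial Finset CategoryTheory AlgebraicGeometry

noncomputable section

namespace Literature.AlgebraicGeometry.Motives

/-! ### §1 `χ = deg B − deg A` in every presentation -/

section Pure

/-- **`deg T^N p(c/T) ≤ N`** (for `deg p ≤ N`). [cite: Hartshorne1977, App. C §1 (1.2)] -/
theorem natDegree_reflectScale_le {R : Type*} [CommSemiring R] {N : ℕ} (c : R) {p : R[X]} (hp : p.natDegree ≤ N) :
    (reflectScale N c p).natDegree ≤ N := by
  rw [natDegree_le_iff_coeff_eq_zero]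
  intro i hi
  have hcomp : (p.comp (C c * X)).natDegree ≤ N :=
    natDegree_comp_le.trans (by
      calc p.natDegree * (C c * X).natDegree ≤ p.natDegree * 1 :=
            Nat.mul_le_mul_left _ ((natDegree_C_mul_le c X).trans natDegree_X_le)
        _ ≤ N := by rw [mul_one]; exact hp)
  rw [reflectScale, coeff_reflect, revAt_eq_self_of_lt (by exact_mod_cast hi)]
  exact coeff_eq_zero_of_natDegree_lt (hcomp.trans_lt (by exact_mod_cast hi))

/-- **`deg T^N p(c/T) = N` when `p(0) ≠ 0`** (`deg p ≤ N`): the top coefficient is `p(0)`.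
[cite: Hartshorne1977, App. C §1 (1.2)] -/
theorem natDegree_reflectScale_of_coeff_zero_ne_zero {R : Type*} [CommSemiring R] {N : ℕ} (c : R) {p : R[X]}
    (hp : p.natDegree ≤ N) (h0 : p.coeff 0 ≠ 0) : (reflectScale N c p).natDegree = N := by
  refine le_antisymm (natDegree_reflectScale_le c hp) (le_natDegree_of_ne_zero ?_)
  rwa [coeff_reflectScale_self]

/-- **The Euler characteristic of a functional equation is `deg B − deg A`.**  If `Z ∈ ℚ⟦T⟧` with `Z(0) ≠ 0` has a
rational presentation `Z·B = A` (`B(0) ≠ 0`, `deg A, deg B ≤ N`) satisfying the cross-multiplied functional equation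
`T^{χ⁻}·Ã·B = e·q^{nχ/2}·T^{χ⁺}·A·B̃` in `ℝ[T]` (`e` any real constant — for `HasFunctionalEquation`,
`e = ε = ±1`), then `χ = deg B − deg A`: compare degrees, using `deg Ã = deg B̃ = N` (`A(0) = Z(0)B(0) ≠ 0`).
[cite: Kahn2020, §3.6 Thm. 3.65 and (3.6.6)] [cite: Hartshorne1977, App. C Thm. 4.4] -/
theorem functionalEquation_eulerChar_eq {q n : ℕ} {Z : PowerSeries ℚ}
    (hZ0 : PowerSeries.constantCoeff Z ≠ 0) {χ : ℤ}
    {A B : ℚ[X]} {N : ℕ} {e : ℝ} (hB0 : B.coeff 0 ≠ 0) (hZ : Z * (B : PowerSeries ℚ) = A)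
    (hA : A.natDegree ≤ N) (hB : B.natDegree ≤ N)
    (hfe : X ^ (-χ).toNat * (reflectScale N ((q : ℚ) ^ n)⁻¹ A).map (algebraMap ℚ ℝ) * B.map (algebraMap ℚ ℝ) =
      C (e * (q : ℝ) ^ ((n : ℝ) * χ / 2)) * X ^ χ.toNat *
        A.map (algebraMap ℚ ℝ) * (reflectScale N ((q : ℚ) ^ n)⁻¹ B).map (algebraMap ℚ ℝ)) :
    χ = (B.natDegree : ℤ) - A.natDegree := by
  set f := algebraMap ℚ ℝ with hf
  set c : ℚ := ((q : ℚ) ^ n)⁻¹ with hc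
  have hfi : Function.Injective f := (algebraMap ℚ ℝ).injective
  -- `A(0) = Z(0) B(0) ≠ 0`
  have hA0 : A.coeff 0 ≠ 0 := by
    have h := congrArg PowerSeries.constantCoeff hZ
    rw [map_mul, Polynomial.constantCoeff_coe, Polynomial.constantCoeff_coe] at h
    rw [← h]
    exact mul_ne_zero hZ0 hB0
  have hAne : A ≠ 0 := fun h => hA0 (by rw [h, coeff_zero])
  have hBne : B ≠ 0 := fun h => hB0 (by rw [h, coeff_zero])
  have hAt : (reflectScale N c A).natDegree = N := natDegree_reflectScale_of_coeff_zero_ne_zero c hA hA0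
  have hBt : (reflectScale N c B).natDegree = N := natDegree_reflectScale_of_coeff_zero_ne_zero c hB hB0
  have hAtne : reflectScale N c A ≠ 0 := reflectScale_ne_zero_of_coeff_zero_ne_zero N c hA0
  have hBtne : reflectScale N c B ≠ 0 := reflectScale_ne_zero_of_coeff_zero_ne_zero N c hB0
  -- the left-hand side is non-zero, so the constant `e q^{nχ/2}` is non-zero
  have hL : X ^ (-χ).toNat * (reflectScale N c A).map f * B.map f ≠ 0 :=
    mul_ne_zero (mul_ne_zero (pow_ne_zero _ X_ne_zero) ((Polynomial.map_ne_zero_iff hfi).mpr hAtne))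
      ((Polynomial.map_ne_zero_iff hfi).mpr hBne)
  have hconst : e * (q : ℝ) ^ ((n : ℝ) * χ / 2) ≠ 0 := by
    intro h0
    rw [h0, C_0, zero_mul, zero_mul, zero_mul] at hfe
    exact hL hfe
  -- degrees of both sides
  have hdegL : (X ^ (-χ).toNat * (reflectScale N c A).map f * B.map f).natDegree = (-χ).toNat + N + B.natDegree := by
    rw [natDegree_mul (mul_ne_zero (pow_ne_zero _ X_ne_zero) ((Polynomial.map_ne_zero_iff hfi).mpr hAtne))
      ((Polynomial.map_ne_zero_iff hfi).mpr hBne), natDegree_mul (pow_ne_zero _ X_ne_zero)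
      ((Polynomial.map_ne_zero_iff hfi).mpr hAtne), natDegree_X_pow, natDegree_map_eq_of_injective hfi,
      natDegree_map_eq_of_injective hfi, hAt]
  have hdegR : (C (e * (q : ℝ) ^ ((n : ℝ) * χ / 2)) * X ^ χ.toNat * A.map f * (reflectScale N c B).map f).natDegree =
      χ.toNat + A.natDegree + N := by
    rw [mul_assoc, mul_assoc, natDegree_C_mul hconst, natDegree_mul (pow_ne_zero _ X_ne_zero)
      (mul_ne_zero ((Polynomial.map_ne_zero_iff hfi).mpr hAne) ((Polynomial.map_ne_zero_iff hfi).mpr hBtne)),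
      natDegree_mul ((Polynomial.map_ne_zero_iff hfi).mpr hAne) ((Polynomial.map_ne_zero_iff hfi).mpr hBtne),
      natDegree_X_pow, natDegree_map_eq_of_injective hfi, natDegree_map_eq_of_injective hfi, hBt, add_assoc]
  have hdeg := congrArg natDegree hfe
  rw [hdegL, hdegR] at hdeg
  have key : ((χ.toNat : ℕ) : ℤ) - (((-χ).toNat : ℕ) : ℤ) = (B.natDegree : ℤ) - A.natDegree := by omega
  rw [Int.toNat_sub_toNat_neg] at key
  exact key

/-- **`HasFunctionalEquation` pins `χ`: `χ = deg B − deg A` for EVERY rational presentation `Z·B' = A'`**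
(`B'(0) ≠ 0`) of a series `Z` with `Z(0) ≠ 0` admitting a functional equation with exponent `χ` — the presentation
inside `HasFunctionalEquation` gives `χ = deg B − deg A` (above), and `deg B − deg A` is presentation independent
(the tree's `natDegree_sub_natDegree_eq`). [cite: Kahn2020, §3.6 Thm. 3.65] [cite: Hartshorne1977, App. C Thm. 4.4] -/
theorem HasFunctionalEquation.eulerChar_eq_natDegree_sub {q n : ℕ} {Z : PowerSeries ℚ} {χ : ℤ}
    (h : HasFunctionalEquation q n Z χ) (hZ0 : PowerSeries.constantCoeff Z ≠ 0)
    {A' B' : ℚ[X]} (hB'0 : B'.coeff 0 ≠ 0) (hZ' : Z * (B' : PowerSeries ℚ) = A') :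
    χ = (B'.natDegree : ℤ) - A'.natDegree := by
  obtain ⟨A, B, N, ε, hB0, hZ, hA, hB, hfe⟩ := h
  have hχ := functionalEquation_eulerChar_eq hZ0 hB0 hZ hA hB hfe
  -- presentation independence of `deg B − deg A` (over `K = ℚ`)
  have hA'0 : A'.coeff 0 ≠ 0 := by
    have h := congrArg PowerSeries.constantCoeff hZ'
    rw [map_mul, Polynomial.constantCoeff_coe, Polynomial.constantCoeff_coe] at h
    rw [← h]
    exact mul_ne_zero hZ0 hB'0
  have hZ'' : Z.map (algebraMap ℚ ℚ) * (B' : PowerSeries ℚ) = A' := by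
    rw [Algebra.algebraMap_self, PowerSeries.map_id]
    exact hZ'
  rw [hχ]
  exact Literature.NumberTheory.LFunctions.WeilFunctionalEquation.natDegree_sub_natDegree_eq hB0 hZ hA'0 hB'0 hZ''

/-- **The exponent `χ` of the functional equation is unique**: if a series `Z ∈ ℚ⟦T⟧` with `Z(0) ≠ 0` satisfies
`HasFunctionalEquation q n Z χ` and `HasFunctionalEquation q n Z χ'`, then `χ = χ'`.
[cite: Kahn2020, §3.6 Thm. 3.65] [cite: Hartshorne1977, App. C Thm. 4.4] -/
theorem HasFunctionalEquation.eulerChar_unique {q n : ℕ} {Z : PowerSeries ℚ} {χ χ' : ℤ}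
    (h : HasFunctionalEquation q n Z χ) (h' : HasFunctionalEquation q n Z χ') (hZ0 : PowerSeries.constantCoeff Z ≠ 0) :
    χ = χ' := by
  obtain ⟨A, B, N, ε, hB0, hZ, hA, hB, hfe⟩ := h'
  rw [h.eulerChar_eq_natDegree_sub hZ0 hB0 hZ]
  exact (functionalEquation_eulerChar_eq hZ0 hB0 hZ hA hB hfe).symm

end Pure

/-! ### §2 `E`-level: the exponent of ANY functional equation of `Z(X, T)` is `Σ(−1)ⁱ bᵢ(X)` -/

namespace GaloisWeilCohomology

variable {k : Type u} [Field k] [Finite k] {K : Type v} [Field K] [CharZero K]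
  {χ : Field.absoluteGaloisGroup k →* Kˣ} (E : GaloisWeilCohomology k K χ) {d : ℕ} {X : SchemeOver k}

/-- **If `Z(X, T)` satisfies a functional equation `Z(X, 1/(qⁿT)) = ±q^{nm/2}T^m Z(X, T)` (the tree's
`HasFunctionalEquation q n (zetaSeries X) m`, any `n`), then `m = χ(X) = Σ_{i ≤ 2d} (−1)ⁱ dim_K Hⁱ(X)`** for `X`
smooth projective of dimension `d` over `𝔽_q` and `E` with the Lefschetz trace formula and `χ(φ) = q` (no Riemann
hypothesis): Hartshorne's «`E` is the self-intersection number of the diagonal» ∕ Kahn's `χ = Σ(−1)ⁱ deg Pᵢ`, read off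
an ARBITRARY functional equation. [cite: Kahn2020, §3.6 Thm. 3.65] [cite: Hartshorne1977, App. C Thm. 4.4]
[cite: Deligne1974, (2.6)] -/
theorem eulerChar_eq_of_hasFunctionalEquation (hE : E.HasLefschetzTraceFormula)
    (hχ : ((χ (arithFrob k) : Kˣ) : K) = Nat.card k) (hX : IsSmoothProjective d X) {n : ℕ} {m : ℤ}
    (h : HasFunctionalEquation (Nat.card k) n (zetaSeries X) m) :
    m = ∑ i ∈ Finset.range (2 * d + 1), (-1 : ℤ) ^ i * (Module.finrank K (E.obj X i) : ℤ) := by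
  obtain ⟨A, B, hB0, hZ⟩ := E.exists_polynomial_mul_zetaSeries_eq_of_hasLefschetzTraceFormula hE hX
  have hZ0 : PowerSeries.constantCoeff (zetaSeries X) ≠ 0 := by
    rw [constantCoeff_zetaSeries]
    exact one_ne_zero
  rw [h.eulerChar_eq_natDegree_sub hZ0 hB0 hZ]
  exact E.natDegree_sub_natDegree_eq_eulerChar hE hχ hX hB0 hZ

/-- **Uniqueness of the exponent for zeta functions, `E`-free form**: two functional equations of the same
`Z(X, T)` have the same `χ` (`Z(X, 0) = 1`). [cite: Kahn2020, §3.6 Thm. 3.65] [cite: Hartshorne1977, App. C Thm. 4.4] -/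
theorem _root_.Literature.AlgebraicGeometry.Motives.hasFunctionalEquation_zetaSeries_eulerChar_unique
    (X : SchemeOver k) {n : ℕ} {m m' : ℤ}
    (h : HasFunctionalEquation (Nat.card k) n (zetaSeries X) m) (h' : HasFunctionalEquation (Nat.card k) n (zetaSeries X) m') :
    m = m' :=
  h.eulerChar_unique h' (by rw [constantCoeff_zetaSeries]; exact one_ne_zero)

end GaloisWeilCohomology

/-! ### §3 The quadrics of `ℙ^{2l+3}`: `χ = 2l+4` in every functional equation -/

section Quadrics

open SmoothHypersurface (hypersurface)

variable {k : Type u} [Field k] [Finite k] (l : ℕ)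

/-- `l + 1 ≤ 2l + 2 + 2` (any proof matches the tree's by proof irrelevance). [folklore] -/
private theorem leE' (l : ℕ) : l + 1 ≤ 2 * l + 2 + 2 := by omega

/-- The middle coordinate `l + 1`. [folklore] -/
private theorem ltE₁' (l : ℕ) : l + 1 < 2 * l + 2 + 2 := by omega

/-- The middle coordinate `l + 2`. [folklore] -/
private theorem ltE₂' (l : ℕ) : l + 2 < 2 * l + 2 + 2 := by omega

/-- `l + 2 ≤ 2l + 2 + 2`. [folklore] -/
private theorem leS' (l : ℕ) : l + 2 ≤ 2 * l + 2 + 2 := by omega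

/-- `deg (∏_{i<2l+3}(1 − qⁱT) · (1 + cT)) = 2l+4` for `q, c ≠ 0`, `(…)(0) ≠ 0`, and the coercion to `ℚ⟦T⟧` of the
product. [folklore] -/
private theorem denominator_aux' {q : ℚ} (hq : q ≠ 0) {c : ℚ} (hc : c ≠ 0) :
    ((∏ i ∈ range (2 * l + 3), (1 - C (q ^ i) * X : ℚ[X])) * (1 + C c * X)).natDegree = 2 * l + 4 ∧
      ((∏ i ∈ range (2 * l + 3), (1 - C (q ^ i) * X : ℚ[X])) * (1 + C c * X)).coeff 0 ≠ 0 ∧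
      ((((∏ i ∈ range (2 * l + 3), (1 - C (q ^ i) * X : ℚ[X])) * (1 + C c * X) : ℚ[X])) : PowerSeries ℚ) =
        (∏ i ∈ range (2 * l + 3), (((1 - C (q ^ i) * X : ℚ[X])) : PowerSeries ℚ)) *
          (((1 + C c * X : ℚ[X])) : PowerSeries ℚ) := by
  have hlin : ∀ i, (1 - C (q ^ i) * X : ℚ[X]) = C (-(q ^ i)) * X + C 1 := fun i => by rw [map_neg, C_1]; ring
  have hlin' : (1 + C c * X : ℚ[X]) = C c * X + C 1 := by rw [C_1]; ring
  have hdeg1 : ∀ i, (1 - C (q ^ i) * X : ℚ[X]).natDegree = 1 := fun i => by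
    rw [hlin, natDegree_linear (neg_ne_zero.mpr (pow_ne_zero _ hq))]
  have hne1 : ∀ i ∈ range (2 * l + 3), (1 - C (q ^ i) * X : ℚ[X]) ≠ 0 := fun i _ h => by
    have := hdeg1 i
    rw [h, natDegree_zero] at this
    exact zero_ne_one this
  have hdeg2 : (1 + C c * X : ℚ[X]).natDegree = 1 := by rw [hlin', natDegree_linear hc]
  have hne2 : (1 + C c * X : ℚ[X]) ≠ 0 := fun h => by
    rw [h, natDegree_zero] at hdeg2
    exact zero_ne_one hdeg2
  refine ⟨?_, ?_, ?_⟩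
  · rw [natDegree_mul (prod_ne_zero_iff.mpr hne1) hne2, natDegree_prod _ _ hne1, hdeg2]
    simp only [hdeg1, sum_const, card_range, smul_eq_mul, mul_one]
  · rw [coeff_zero_eq_eval_zero, eval_mul, eval_prod]
    simp
  · rw [Polynomial.coe_mul, ← Polynomial.coeToPowerSeries.ringHom_apply, map_prod]
    simp only [Polynomial.coeToPowerSeries.ringHom_apply]

/-- **Every functional equation of `Z(ℰ_{2l+3}, T)` has exponent `χ = 2l+4 = χ(ℰ_{2l+3})`** (the elliptic quadric
over `𝔽_q`, `ε₀` a non-square; any `n`): its presentation `Z(ℰ)·∏_{i≤2l+2}(1 − qⁱT)·(1 + q^{l+1}T) = 1` (g51-#11) has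
`deg B − deg A = 2l+4`. [cite: Kahn2020, §3.6 Thm. 3.65 and Remark 3.66] [cite: Hirschfeld1998, §5.2 Thm. 5.2.6 (iii)] -/
theorem eulerChar_eq_of_hasFunctionalEquation_ellipticQuadric {ε₀ : k} (hε₀ : ¬IsSquare ε₀) {n : ℕ} {m : ℤ}
    (h : HasFunctionalEquation (Nat.card k) n (zetaSeries
      (hypersurface ((∑ i : Fin (l + 1), MvPolynomial.X (Fin.castLE (leE' l) i) *
          MvPolynomial.X (Fin.rev (Fin.castLE (leE' l) i))) + MvPolynomial.X (Fin.mk (l + 1) (ltE₁' l)) ^ 2 -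
          MvPolynomial.C ε₀ * MvPolynomial.X (Fin.mk (l + 2) (ltE₂' l)) ^ 2 : MvPolynomial (Fin (2 * l + 2 + 2)) k))) m) :
    m = ((2 * l + 4 : ℕ) : ℤ) := by
  have hq : (Nat.card k : ℚ) ≠ 0 := by exact_mod_cast Nat.card_pos.ne'
  obtain ⟨hdeg, h0, hcoe⟩ := denominator_aux' l hq (pow_ne_zero (l + 1) hq)
  have hZ' : zetaSeries
        (hypersurface ((∑ i : Fin (l + 1), MvPolynomial.X (Fin.castLE (leE' l) i) *
          MvPolynomial.X (Fin.rev (Fin.castLE (leE' l) i))) + MvPolynomial.X (Fin.mk (l + 1) (ltE₁' l)) ^ 2 -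
          MvPolynomial.C ε₀ * MvPolynomial.X (Fin.mk (l + 2) (ltE₂' l)) ^ 2 : MvPolynomial (Fin (2 * l + 2 + 2)) k)) *
      ((((∏ i ∈ range (2 * l + 3), (1 - C ((Nat.card k : ℚ) ^ i) * X : ℚ[X])) *
          (1 + C ((Nat.card k : ℚ) ^ (l + 1)) * X) : ℚ[X])) : PowerSeries ℚ) = ((1 : ℚ[X]) : PowerSeries ℚ) := by
    rw [hcoe, Polynomial.coe_one]
    exact zetaSeries_ellipticQuadric_mul_prod l hε₀
  rw [h.eulerChar_eq_natDegree_sub (by rw [constantCoeff_zetaSeries]; exact one_ne_zero) h0 hZ', hdeg, natDegree_one]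
  simp

/-- **Every functional equation of `Z(ℋ_{2l+3}, T)` has exponent `χ = 2l+4 = χ(ℋ_{2l+3})`** (the hyperbolic
quadric, units `εᵢ`; any `n`). [cite: Kahn2020, §3.6 Thm. 3.65] [cite: Hirschfeld1998, §5.2 Thm. 5.2.6 (ii)] -/
theorem eulerChar_eq_of_hasFunctionalEquation_splitQuadric (ε₁ : Fin (l + 2) → kˣ) {n : ℕ} {m : ℤ}
    (h : HasFunctionalEquation (Nat.card k) n (zetaSeries
      (hypersurface (∑ i : Fin (l + 2), MvPolynomial.C (ε₁ i : k) * MvPolynomial.X (Fin.castLE (leS' l) i) *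
          MvPolynomial.X (Fin.rev (Fin.castLE (leS' l) i)) : MvPolynomial (Fin (2 * l + 2 + 2)) k))) m) :
    m = ((2 * l + 4 : ℕ) : ℤ) := by
  have hq : (Nat.card k : ℚ) ≠ 0 := by exact_mod_cast Nat.card_pos.ne'
  obtain ⟨hdeg, h0, hcoe⟩ := denominator_aux' l hq (neg_ne_zero.mpr (pow_ne_zero (l + 1) hq))
  have hsub : (1 + C (-((Nat.card k : ℚ) ^ (l + 1))) * X : ℚ[X]) = 1 - C ((Nat.card k : ℚ) ^ (l + 1)) * X := by
    rw [map_neg]; ring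
  rw [hsub] at hdeg h0 hcoe
  have hZ' : zetaSeries
        (hypersurface (∑ i : Fin (l + 2), MvPolynomial.C (ε₁ i : k) * MvPolynomial.X (Fin.castLE (leS' l) i) *
          MvPolynomial.X (Fin.rev (Fin.castLE (leS' l) i)) : MvPolynomial (Fin (2 * l + 2 + 2)) k)) *
      ((((∏ i ∈ range (2 * l + 3), (1 - C ((Nat.card k : ℚ) ^ i) * X : ℚ[X])) *
          (1 - C ((Nat.card k : ℚ) ^ (l + 1)) * X) : ℚ[X])) : PowerSeries ℚ) = ((1 : ℚ[X]) : PowerSeries ℚ) := by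
    rw [hcoe, Polynomial.coe_one]
    exact zetaSeries_splitQuadric_mul_prod l ε₁
  rw [h.eulerChar_eq_natDegree_sub (by rw [constantCoeff_zetaSeries]; exact one_ne_zero) h0 hZ', hdeg, natDegree_one]
  simp

end Quadrics

end Literature.AlgebraicGeometry.Motives

end
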